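import Summits.CriticalPhenomena.PercolationContinuityZ3.Theorems.SahiMasterFamilyTerminalPrelim
import Summits.CriticalPhenomena.PercolationContinuityZ3.Theorems.SahiMasterFamilyL3

/-!
# The terminal class of (T): every terminal triple has `E_3 ≢ 0` — hence (T) and `MasterFamilyIdentEqIff 3`

Final assembly of the unit's programme (unit `prim-master-conj`; paper STRUCTURE-PROOF.md, verified
VERIFICATION-gen3.md).  A terminal triple (`TerminalTriple`: pairwise dependent, no common pivotal coordinate, all
minors in `Z_3`) of increasing events has, by Lemma P, no private coordinate; by the local trichotomy (L2, HS, NS, SS)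
either it is THE TRIANGLE `{e∨s, e∨t, s∨t}` — whose events have top Möbius coefficient `−1`, so
`sahiE3Nonvanishing_of_mobCoeff` applies — or no coordinate saturates any event, and then L3 (an N0 coordinate forces a
pure event) and Step A (otherwise every shared coordinate is mandatory for exactly one event, and some event is pure)
produce a PURE event, i.e. a cylinder `{ω | S ⊆ ω}`, for which (EQ-3) is the tree's unconditional
`sahiE_three_ind_eq_zero_iff_of_cylinder` (Blinovsky's chain, `SahiMasterFamilyEqPrincipal.lean`).

* `SahiE3NonvanishingOfTerminal_holds : SahiE3NonvanishingOfTerminal`;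
* `SahiE3NonvanishingOfPairwiseDependent_holds : SahiE3NonvanishingOfPairwiseDependent` ((T));
* `masterFamilyIdentEqIff_three : MasterFamilyIdentEqIff 3` — **the identically-zero form of the `k = 3` master
  equality conjecture is a theorem**: for three increasing events on a finite set, `E_3(μ_p) = 0` for every `p` in
  the open cube iff the triple lies in the zero-flag class `Z_3` (criterion (Z)).
Everything here is proved; axioms standard. [this work]
-/

noncomputable section

open scoped Classical

namespace Summit.CriticalPhenomena.PercolationContinuityZ3.Theorems

open Finset Function
open Literature.Combinatorics.Sahi2008
open Literature.Probability.Percolation (DeterminedBy determinedBy_iff)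
open Literature.Probability.Percolation.DecisionTree (ind ind_of_mem ind_of_not_mem ind_nonneg)
open Literature.Probability.LatticeModels.Kahn2022 (Affects)

variable {ι : Type*} [Fintype ι]

/-! ### The core: terminal triples have `E_3 ≢ 0` -/

/-- **Terminal triples have `E_3(μ_p) ≠ 0` for some interior `p`** (hypotheses in explicit form for the ordered triple
`(A, B, C)`). [this work] -/
theorem terminal_core {ι : Type} [Fintype ι] {A B C : Set (Set ι)}
    (hA : IsUpperSet A) (hB : IsUpperSet B) (hC : IsUpperSet C)
    (hAB : (esupp A ∩ esupp B).Nonempty) (hAC : (esupp A ∩ esupp C).Nonempty) (hBC : (esupp B ∩ esupp C).Nonempty)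
    (hprivA : esupp A ⊆ esupp B ∪ esupp C) (hprivB : esupp B ⊆ esupp A ∪ esupp C)
    (hprivC : esupp C ⊆ esupp A ∪ esupp B) (hcommon : ∀ i, i ∈ esupp A → i ∈ esupp B → i ∉ esupp C)
    (hmin : ∀ i ∈ esupp A ∪ esupp B ∪ esupp C, ∀ b : Bool, SuppZeroFlag 3 ![secAt i b A, secAt i b B, secAt i b C]) :
    ∃ p : ι → unitInterval, (∀ e, (p e : ℝ) ∈ Set.Ioo (0 : ℝ) 1) ∧
      sahiE (bernoulliWeight p) 3 (fun j => ind ((![A, B, C] : Fin 3 → Set (Set ι)) j)) ≠ 0 := by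
  -- basic facts
  have hU : ∀ j, IsUpperSet ((![A, B, C] : Fin 3 → Set (Set ι)) j) := by
    intro j; fin_cases j <;> assumption
  have hBA : (esupp B ∩ esupp A).Nonempty := by rwa [inter_comm]
  have hCA : (esupp C ∩ esupp A).Nonempty := by rwa [inter_comm]
  have hCB : (esupp C ∩ esupp B).Nonempty := by rwa [inter_comm]
  have hpair : ∀ a b : Fin 3, a ≠ b →
      (esupp ((![A, B, C] : Fin 3 → Set (Set ι)) a) ∩ esupp ((![A, B, C] : Fin 3 → Set (Set ι)) b)).Nonempty := by
    intro a b hab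
    fin_cases a <;> fin_cases b <;> first | exact absurd rfl hab | assumption
  have hAne : A.Nonempty := by obtain ⟨i, hi⟩ := hAB; exact (nonempty_of_esupp_nonempty ⟨i, (mem_inter.1 hi).1⟩).1
  have hBne : B.Nonempty := by obtain ⟨i, hi⟩ := hAB; exact (nonempty_of_esupp_nonempty ⟨i, (mem_inter.1 hi).2⟩).1
  have hCne : C.Nonempty := by obtain ⟨i, hi⟩ := hAC; exact (nonempty_of_esupp_nonempty ⟨i, (mem_inter.1 hi).2⟩).1
  -- permuted forms of `hcommon`, `hpriv`, `hmin`
  have hcACB : ∀ i, i ∈ esupp A → i ∈ esupp C → i ∉ esupp B := fun i hA' hC' hB' => hcommon i hA' hB' hC'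
  have hcBAC : ∀ i, i ∈ esupp B → i ∈ esupp A → i ∉ esupp C := fun i hB' hA' => hcommon i hA' hB'
  have hcBCA : ∀ i, i ∈ esupp B → i ∈ esupp C → i ∉ esupp A := fun i hB' hC' hA' => hcommon i hA' hB' hC'
  have hcCAB : ∀ i, i ∈ esupp C → i ∈ esupp A → i ∉ esupp B := fun i hC' hA' hB' => hcommon i hA' hB' hC'
  have hcCBA : ∀ i, i ∈ esupp C → i ∈ esupp B → i ∉ esupp A := fun i hC' hB' hA' => hcommon i hA' hB' hC'
  have hpA' : esupp A ⊆ esupp C ∪ esupp B := by rwa [union_comm]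
  have hpB' : esupp B ⊆ esupp C ∪ esupp A := by rwa [union_comm]
  have hpC' : esupp C ⊆ esupp B ∪ esupp A := by rwa [union_comm]
  have up : ∀ (X : Set (Set ι)) (i : ι) (b : Bool), IsUpperSet X → IsUpperSet (secAt i b X) :=
    fun X i b h => isUpperSet_secAt i b h
  have memW : ∀ {i : ι} {P Q R : Finset ι}, i ∈ P ∪ Q ∪ R → i ∈ Q ∪ P ∪ R ∧ i ∈ P ∪ R ∪ Q ∧ i ∈ R ∪ P ∪ Q ∧
      i ∈ Q ∪ R ∪ P ∧ i ∈ R ∪ Q ∪ P := by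
    intro i P Q R h; simp only [mem_union] at h ⊢; tauto
  have hmBAC : ∀ i ∈ esupp B ∪ esupp A ∪ esupp C, ∀ b : Bool,
      SuppZeroFlag 3 ![secAt i b B, secAt i b A, secAt i b C] := fun i hi b =>
    (suppZeroFlag_three_swap12 (up A i b hA) (up B i b hB) (up C i b hC)).1 (hmin i (memW hi).1 b)
  have hmACB : ∀ i ∈ esupp A ∪ esupp C ∪ esupp B, ∀ b : Bool,
      SuppZeroFlag 3 ![secAt i b A, secAt i b C, secAt i b B] := fun i hi b =>
    (suppZeroFlag_three_swap23 (up A i b hA) (up B i b hB) (up C i b hC)).1 (hmin i (memW hi).2.1 b)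
  have hmCAB : ∀ i ∈ esupp C ∪ esupp A ∪ esupp B, ∀ b : Bool,
      SuppZeroFlag 3 ![secAt i b C, secAt i b A, secAt i b B] := fun i hi b =>
    (suppZeroFlag_three_swap12 (up A i b hA) (up C i b hC) (up B i b hB)).1 (hmACB i (memW hi).1 b)
  have hmBCA : ∀ i ∈ esupp B ∪ esupp C ∪ esupp A, ∀ b : Bool,
      SuppZeroFlag 3 ![secAt i b B, secAt i b C, secAt i b A] := fun i hi b =>
    (suppZeroFlag_three_swap23 (up B i b hB) (up A i b hA) (up C i b hC)).1 (hmBAC i (memW hi).2.1 b)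
  have hmCBA : ∀ i ∈ esupp C ∪ esupp B ∪ esupp A, ∀ b : Bool,
      SuppZeroFlag 3 ![secAt i b C, secAt i b B, secAt i b A] := fun i hi b =>
    (suppZeroFlag_three_swap12 (up B i b hB) (up C i b hC) (up A i b hA)).1 (hmBCA i (memW hi).1 b)
  by_cases hsat : (∃ f ∈ esupp A, secAt f true A = Set.univ) ∨ (∃ f ∈ esupp B, secAt f true B = Set.univ) ∨
      (∃ f ∈ esupp C, secAt f true C = Set.univ)
  · -- THE TRIANGLE
    apply sahiE_three_ne_zero_of_triangle hU hpair
    rcases hsat with ⟨f, hf, hs⟩ | ⟨f, hf, hs⟩ | ⟨f, hf, hs⟩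
    · rcases mem_union.1 (hprivA hf) with hf' | hf'
      · obtain ⟨s, t, eA, eB, eC, qA, qB, qC⟩ :=
          triangle_of_saturation hA hB hC hAC hBC hprivA hprivB hprivC hcommon hmin hf hf' hs
        have hfs : f ≠ s := fun h => hcommon f hf hf' (by rw [eC, h]; simp)
        have hft : f ≠ t := fun h => hcommon f hf hf' (by rw [eC, h]; simp)
        have hst : s ≠ t := fun h => hcommon s (by rw [eA]; simp) (by rw [eB, h]; simp) (by rw [eC]; simp)
        intro j; fin_cases j
        · exact ⟨f, s, hfs, qA, eA⟩
        · exact ⟨f, t, hft, qB, eB⟩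
        · exact ⟨s, t, hst, qC, eC⟩
      · obtain ⟨s, t, eA, eC, eB, qA, qC, qB⟩ :=
          triangle_of_saturation hA hC hB hAB hCB hpA' hprivC hprivB hcACB hmACB hf hf' hs
        have hfs : f ≠ s := fun h => hcACB f hf hf' (by rw [eB, h]; simp)
        have hft : f ≠ t := fun h => hcACB f hf hf' (by rw [eB, h]; simp)
        have hst : s ≠ t := fun h => hcACB s (by rw [eA]; simp) (by rw [eC, h]; simp) (by rw [eB]; simp)
        intro j; fin_cases j
        · exact ⟨f, s, hfs, qA, eA⟩
        · exact ⟨s, t, hst, qB, eB⟩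
        · exact ⟨f, t, hft, qC, eC⟩
    · rcases mem_union.1 (hprivB hf) with hf' | hf'
      · obtain ⟨s, t, eB, eA, eC, qB, qA, qC⟩ :=
          triangle_of_saturation hB hA hC hBC hAC hprivB hprivA hpC' hcBAC hmBAC hf hf' hs
        have hfs : f ≠ s := fun h => hcBAC f hf hf' (by rw [eC, h]; simp)
        have hft : f ≠ t := fun h => hcBAC f hf hf' (by rw [eC, h]; simp)
        have hst : s ≠ t := fun h => hcBAC s (by rw [eB]; simp) (by rw [eA, h]; simp) (by rw [eC]; simp)
        intro j; fin_cases j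
        · exact ⟨f, t, hft, qA, eA⟩
        · exact ⟨f, s, hfs, qB, eB⟩
        · exact ⟨s, t, hst, qC, eC⟩
      · obtain ⟨s, t, eB, eC, eA, qB, qC, qA⟩ :=
          triangle_of_saturation hB hC hA hBA hCA hpB' hpC' hprivA hcBCA hmBCA hf hf' hs
        have hfs : f ≠ s := fun h => hcBCA f hf hf' (by rw [eA, h]; simp)
        have hft : f ≠ t := fun h => hcBCA f hf hf' (by rw [eA, h]; simp)
        have hst : s ≠ t := fun h => hcBCA s (by rw [eB]; simp) (by rw [eC, h]; simp) (by rw [eA]; simp)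
        intro j; fin_cases j
        · exact ⟨s, t, hst, qA, eA⟩
        · exact ⟨f, s, hfs, qB, eB⟩
        · exact ⟨f, t, hft, qC, eC⟩
    · rcases mem_union.1 (hprivC hf) with hf' | hf'
      · obtain ⟨s, t, eC, eA, eB, qC, qA, qB⟩ :=
          triangle_of_saturation hC hA hB hCB hAB hprivC hpA' hpB' hcCAB hmCAB hf hf' hs
        have hfs : f ≠ s := fun h => hcCAB f hf hf' (by rw [eB, h]; simp)
        have hft : f ≠ t := fun h => hcCAB f hf hf' (by rw [eB, h]; simp)
        have hst : s ≠ t := fun h => hcCAB s (by rw [eC]; simp) (by rw [eA, h]; simp) (by rw [eB]; simp)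
        intro j; fin_cases j
        · exact ⟨f, t, hft, qA, eA⟩
        · exact ⟨s, t, hst, qB, eB⟩
        · exact ⟨f, s, hfs, qC, eC⟩
      · obtain ⟨s, t, eC, eB, eA, qC, qB, qA⟩ :=
          triangle_of_saturation hC hB hA hCA hBA hpC' hpB' hpA' hcCBA hmCBA hf hf' hs
        have hfs : f ≠ s := fun h => hcCBA f hf hf' (by rw [eA, h]; simp)
        have hft : f ≠ t := fun h => hcCBA f hf hf' (by rw [eA, h]; simp)
        have hst : s ≠ t := fun h => hcCBA s (by rw [eC]; simp) (by rw [eB, h]; simp) (by rw [eA]; simp)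
        intro j; fin_cases j
        · exact ⟨s, t, hst, qA, eA⟩
        · exact ⟨f, t, hft, qB, eB⟩
        · exact ⟨f, s, hfs, qC, eC⟩
  · -- NO SATURATION: a pure event exists, and pure events are cylinders
    simp only [not_or, not_exists, not_and] at hsat
    obtain ⟨nsA, nsB, nsC⟩ := hsat
    have hNSA : ∀ s ∈ esupp A, ({s} : Set ι) ∉ A := fun s hs h => nsA s hs ((secAt_true_eq_univ_iff' hA s).2 h)
    have hNSB : ∀ s ∈ esupp B, ({s} : Set ι) ∉ B := fun s hs h => nsB s hs ((secAt_true_eq_univ_iff' hB s).2 h)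
    have hNSC : ∀ s ∈ esupp C, ({s} : Set ι) ∉ C := fun s hs h => nsC s hs ((secAt_true_eq_univ_iff' hC s).2 h)
    have hpure : (∀ f ∈ esupp A, secAt f false A = ∅) ∨ (∀ f ∈ esupp B, secAt f false B = ∅) ∨
        (∀ f ∈ esupp C, secAt f false C = ∅) := by
      by_cases hN0AB : ∃ e ∈ esupp A ∩ esupp B, Set.univ \ {e} ∈ A ∧ Set.univ \ {e} ∈ B
      · obtain ⟨e, he, h1, h2⟩ := hN0AB
        exact Or.inr (Or.inr (lemma_L3 hA hB hC hAB hAC hBC hprivA hprivB hprivC hcommon hNSA hNSB hNSC hmin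
          (mem_inter.1 he).1 (mem_inter.1 he).2 h1 h2))
      by_cases hN0AC : ∃ e ∈ esupp A ∩ esupp C, Set.univ \ {e} ∈ A ∧ Set.univ \ {e} ∈ C
      · obtain ⟨e, he, h1, h2⟩ := hN0AC
        exact Or.inr (Or.inl (lemma_L3 hA hC hB hAC hAB hCB hpA' hprivC hprivB hcACB hNSA hNSC hNSB hmACB
          (mem_inter.1 he).1 (mem_inter.1 he).2 h1 h2))
      by_cases hN0BC : ∃ e ∈ esupp B ∩ esupp C, Set.univ \ {e} ∈ B ∧ Set.univ \ {e} ∈ C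
      · obtain ⟨e, he, h1, h2⟩ := hN0BC
        exact Or.inl (lemma_L3 hB hC hA hBC hBA hCA hpB' hpC' hprivA hcBCA hNSB hNSC hNSA hmBCA
          (mem_inter.1 he).1 (mem_inter.1 he).2 h1 h2)
      -- every shared coordinate is mandatory for exactly one of its events
      have gtype : ∀ {X Y Z : Set (Set ι)}, IsUpperSet X → IsUpperSet Y → IsUpperSet Z →
          X.Nonempty → Y.Nonempty → Z.Nonempty → (esupp X ∩ esupp Z).Nonempty →
          (∀ i, i ∈ esupp X → i ∈ esupp Y → i ∉ esupp Z) → (∀ i, i ∈ esupp X → i ∈ esupp Z → i ∉ esupp Y) →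
          (∀ i ∈ esupp X ∪ esupp Y ∪ esupp Z, ∀ b : Bool, SuppZeroFlag 3 ![secAt i b X, secAt i b Y, secAt i b Z]) →
          (¬ ∃ e ∈ esupp X ∩ esupp Y, Set.univ \ {e} ∈ X ∧ Set.univ \ {e} ∈ Y) →
          ∀ f, f ∈ esupp X → f ∈ esupp Y → (secAt f false X = ∅ ↔ secAt f false Y ≠ ∅) := by
        intro X Y Z hX hY hZ hXne hYne hZne hXZ hcXYZ hcXZY hm hN0 f hfX hfY
        constructor
        · intro hmX hmY
          obtain ⟨s, hs⟩ := hXZ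
          have hsX := (mem_inter.1 hs).1
          have hsZ := (mem_inter.1 hs).2
          have hse : s ≠ f := fun h => hcXYZ f hfX hfY (h ▸ hsZ)
          exact lemma_L2 hX hY hZ hXne hYne hZne hse hfY (hcXYZ f hfX hfY) (hcXZY s hsX hsZ) hmX hmY
            (hm s (by simp [hsX]) true)
        · intro hmY
          by_contra hmX
          refine hN0 ⟨f, mem_inter.2 ⟨hfX, hfY⟩, ?_, ?_⟩
          · by_contra h; exact hmX ((secAt_false_eq_empty_iff hX f).2 h)
          · by_contra h; exact hmY ((secAt_false_eq_empty_iff hY f).2 h)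
      have hGAB := gtype hA hB hC hAne hBne hCne hAC hcommon hcACB hmin hN0AB
      have hGAC := gtype hA hC hB hAne hCne hBne hAB hcACB hcommon hmACB hN0AC
      have hGBC := gtype hB hC hA hBne hCne hAne hBA hcBCA hcBAC hmBCA hN0BC
      exact stepA hA hB hC hAne hBne hCne hAB hAC hBC hprivA hprivB hprivC hcommon (fun i hi => hmin i hi true)
        hGAB hGAC hGBC
    -- a pure event is a cylinder; cylinders settle (EQ-3)
    refine ⟨halfParams ι, halfParams_mem_Ioo ι, ?_⟩
    rcases hpure with h | h | h
    · exact sahiE_three_ne_zero_of_cylinder hU hpair 0 _ (eq_cylinder_of_pure hA hAne h) _ (halfParams_mem_Ioo ι)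
    · exact sahiE_three_ne_zero_of_cylinder hU hpair 1 _ (eq_cylinder_of_pure hB hBne h) _ (halfParams_mem_Ioo ι)
    · exact sahiE_three_ne_zero_of_cylinder hU hpair 2 _ (eq_cylinder_of_pure hC hCne h) _ (halfParams_mem_Ioo ι)

/-! ### The theorems -/

/-- **(T) on the terminal class.** [this work] -/
theorem SahiE3NonvanishingOfTerminal_holds : SahiE3NonvanishingOfTerminal := by
  intro ι _ U S hU hUS hT
  obtain ⟨hPD, hnc, hmin⟩ := hT
  have hT' : TerminalTriple U S := ⟨hPD, hnc, hmin⟩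
  -- pairwise-intersecting essential supports
  have hdep : ∀ {X Y : Set (Set ι)}, IsUpperSet X → IsUpperSet Y → ¬ SuppZeroFlag 2 ![X, Y] →
      (esupp X ∩ esupp Y).Nonempty := by
    intro X Y hX hY h
    by_contra hne
    rw [Finset.not_nonempty_iff_eq_empty] at hne
    exact h ((suppZeroFlag_two_iff hX hY).2 (Finset.disjoint_iff_inter_eq_empty.2 hne))
  have e12 : (fun j : Fin 2 => U ((0 : Fin 3).succAbove j)) = ![U 1, U 2] := by funext j; fin_cases j <;> rfl
  have e02 : (fun j : Fin 2 => U ((1 : Fin 3).succAbove j)) = ![U 0, U 2] := by funext j; fin_cases j <;> rfl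
  have e01 : (fun j : Fin 2 => U ((2 : Fin 3).succAbove j)) = ![U 0, U 1] := by funext j; fin_cases j <;> rfl
  have h12 := hPD 0; rw [e12] at h12
  have h02 := hPD 1; rw [e02] at h02
  have h01 := hPD 2; rw [e01] at h01
  have hAB := hdep (hU 0) (hU 1) h01
  have hAC := hdep (hU 0) (hU 2) h02
  have hBC := hdep (hU 1) (hU 2) h12
  -- no common coordinate
  have hcommon : ∀ i, i ∈ esupp (U 0) → i ∈ esupp (U 1) → i ∉ esupp (U 2) := by
    intro i h0 h1 h2
    refine hnc ⟨i, fun j => ?_⟩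
    have hj : Affects (U j) i := by
      fin_cases j
      · exact mem_esupp.1 h0
      · exact mem_esupp.1 h1
      · exact mem_esupp.1 h2
    obtain ⟨ω, hω, hiω⟩ := hj
    exact ⟨ω, fun hi => hω (by rwa [Set.insert_eq_of_mem hi] at hiω), hω, hiω⟩
  -- all minors, in matrix form
  have hsec : ∀ (e : ι) (b : Bool), (fun j => secAt e b (U j)) = ![secAt e b (U 0), secAt e b (U 1), secAt e b (U 2)] := by
    intro e b; funext j; fin_cases j <;> rfl
  have hminW : ∀ i ∈ esupp (U 0) ∪ esupp (U 1) ∪ esupp (U 2), ∀ b : Bool,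
      SuppZeroFlag 3 ![secAt i b (U 0), secAt i b (U 1), secAt i b (U 2)] := by
    intro i hi b
    have hiS : i ∈ S := by
      simp only [mem_union] at hi
      rcases hi with (hi | hi) | hi
      · exact esupp_subset_of_determinedBy (hUS 0) hi
      · exact esupp_subset_of_determinedBy (hUS 1) hi
      · exact esupp_subset_of_determinedBy (hUS 2) hi
    have := hmin i hiS b
    rwa [hsec] at this
  -- no private coordinate (Lemma P, three slots)
  have hprivA : esupp (U 0) ⊆ esupp (U 1) ∪ esupp (U 2) := esupp_subset_union_of_terminal hU hUS hT'
  have up : ∀ (j : Fin 3) (i : ι) (b : Bool), IsUpperSet (secAt i b (U j)) := fun j i b => isUpperSet_secAt i b (hU j)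
  have hprivB : esupp (U 1) ⊆ esupp (U 0) ∪ esupp (U 2) := by
    intro e he
    by_contra hnot
    rw [mem_union, not_or] at hnot
    have heS : e ∈ S := esupp_subset_of_determinedBy (hUS 1) he
    have hmin' : ∀ b : Bool, SuppZeroFlag 3 ![secAt e b (U 1), U 0, U 2] := by
      intro b
      have h := hmin e heS b
      rw [hsec, secAt_eq_self_of_not_affects (hU 0) (fun h' => hnot.1 (mem_esupp.2 h')) b,
        secAt_eq_self_of_not_affects (hU 2) (fun h' => hnot.2 (mem_esupp.2 h')) b] at h
      exact (suppZeroFlag_three_swap12 (hU 0) (up 1 e b) (hU 2)).1 h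
    exact not_both_minors_zeroFlag (hU 1) (hU 0) (hU 2) (by rwa [inter_comm]) hBC hAC hnot.1 hnot.2
      (hmin' false) (hmin' true)
  have hprivC : esupp (U 2) ⊆ esupp (U 0) ∪ esupp (U 1) := by
    intro e he
    by_contra hnot
    rw [mem_union, not_or] at hnot
    have heS : e ∈ S := esupp_subset_of_determinedBy (hUS 2) he
    have hmin' : ∀ b : Bool, SuppZeroFlag 3 ![secAt e b (U 2), U 0, U 1] := by
      intro b
      have h := hmin e heS b
      rw [hsec, secAt_eq_self_of_not_affects (hU 0) (fun h' => hnot.1 (mem_esupp.2 h')) b,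
        secAt_eq_self_of_not_affects (hU 1) (fun h' => hnot.2 (mem_esupp.2 h')) b] at h
      exact (suppZeroFlag_three_swap12 (hU 0) (up 2 e b) (hU 1)).1
        ((suppZeroFlag_three_swap23 (hU 0) (hU 1) (up 2 e b)).1 h)
    exact not_both_minors_zeroFlag (hU 2) (hU 0) (hU 1) (by rwa [inter_comm]) (by rwa [inter_comm]) hAB hnot.1
      hnot.2 (hmin' false) (hmin' true)
  -- the core
  have hF : (fun j => ind (U j)) = fun j => ind ((![U 0, U 1, U 2] : Fin 3 → Set (Set ι)) j) := by
    funext j; fin_cases j <;> rfl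
  rw [hF]
  exact terminal_core (hU 0) (hU 1) (hU 2) hAB hAC hBC hprivA hprivB hprivC hcommon hminW

/-- **(T): `SahiE3NonvanishingOfPairwiseDependent` holds.**  Three increasing events on a finite set, every two of
which share an essential coordinate, have `E_3(μ_p) ≠ 0` for some `p` in the open cube. [this work] -/
theorem SahiE3NonvanishingOfPairwiseDependent_holds : SahiE3NonvanishingOfPairwiseDependent :=
  sahiE3Nonvanishing_of_terminal SahiE3NonvanishingOfTerminal_holds

/-- **The `k = 3` master equality conjecture, identically-zero form, is a theorem**: for three increasing events on a
finite set, `E_3(μ_p; 1_{U_0}, 1_{U_1}, 1_{U_2}) = 0` for every `p ∈ (0,1)^ι` if and only if the triple lies in the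
zero-flag class `Z_3` (criterion (Z): after reordering `(X, Y, G)`, the pairs `(X, Y)`, `(X ∩ G, Y)`, `(X, Y ∩ G)`
are determined by disjoint coordinate sets). [this work] -/
theorem masterFamilyIdentEqIff_three : MasterFamilyIdentEqIff 3 :=
  masterFamilyIdentEqIff_three_iff.2 SahiE3NonvanishingOfPairwiseDependent_holds


end Summit.CriticalPhenomena.PercolationContinuityZ3.Theorems
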